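import Mathlib.MeasureTheory.Constructions.Pi
import Mathlib.MeasureTheory.Measure.Prod
import Mathlib.MeasureTheory.Measure.Lebesgue.Basic
import Mathlib.Topology.Order.IntermediateValue
import Mathlib.Analysis.Convex.Topology
import Literature.ModelTheory.ExponentialFields.SemialgebraicCountableFibres
import Literature.NumberTheory.Transcendental.SemialgebraicMapsProofs
import HarnessLib

/-!
# Grounding: every semialgebraic set has the volume of a semialgebraic down-set

A **coordinatewise down-set of the open positive orthant** is a set `D ⊆ (0, ∞)^{m+1}` with
`x ∈ D`, `0 < yᵢ ≤ xᵢ ∀ i` `⇒ y ∈ D`. This file proves (`Grounding.exists_downset_volume_eq`): for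
every `k`-semialgebraic `S ⊆ ℝ^{m+1}` there is a `k`-semialgebraic down-set `D` with
`vol D = vol S` (in `[0, ∞]`). Together with the polynomial tail decay of finite-volume semialgebraic
down-sets (`DownSetTailDecay.lean`) this feeds the resolution-free routes to Yoshinaga's theorem
(`FiniteVolumeComputable.lean`, `FiniteVolumeElementary.lean`), which need a tail estimate only for
*some* semialgebraic set of the given volume.

The construction is *grounding* (a discrete Steiner symmetrisation): replace every fibre
`S_β = {u | (β, u) ∈ S}` in one coordinate direction by the interval `(0, length S_β)`; this
preserves volume (Cavalieri), makes the set a down-set in that direction, keeps it a down-set in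
the directions already treated, and — the main point — keeps it semialgebraic; then iterate over
the coordinates.

* **Fibre lengths are first-order** (`FibreLength`). Over each `β` membership of `(β, u)` in `S` is
  a locally constant function of `u` off at most `B` points, `B` uniform in `β` (roots of the nonzero
  specialisations of a sign-condition presentation, `exists_card_le_locallyConst`, as in
  `IsSemialgebraic.exists_forall_encard_fibre_one_le`). On each complementary interval of such a
  finite set membership is constant (connectedness), so `length(S_β) > t ≥ 0` iff there are `B + 1`
  open intervals inside `S_β`, pairwise disjoint as far as they are nonempty, of total length `> t`
  (`exists_intervals_of_lt_volume`, `lt_volume_of_intervals`); the latter is a first-order condition,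
  semialgebraic by Tarski–Seidenberg (`isSemialgebraic_intervalWitness`: the endpoints are `2(B+1)`
  extra coordinates projected away, "the interval lies in the fibre" is the complement of a
  projection).
* **Grounding** (`Grounding`). `groundLast S = {(β, t) | 0 < t < length S_β}` is semialgebraic, has
  the volume of `S` (`volume_groundLast`, via `Measure.prod_apply_symm` along
  `ℝ^{m+1} ≃ᵐ ℝ × ℝ^m`), is a down-set in the last coordinate and inherits positivity / the down-set
  property in every other coordinate; `groundAt i` conjugates by the transposition `(i last)`
  (a measure-preserving, semialgebraicity-preserving coordinate permutation), and `groundIter`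
  treats the coordinates one after the other.

## Main statements

* `FibreLength.exists_card_le_locallyConst`, `FibreLength.mem_intervalWitness_iff`,
  `FibreLength.isSemialgebraic_intervalWitness`, `FibreLength.isSemialgebraic_pos_inter_lengthGT` —
  `{(β, t) | 0 < t < length S_β}` is `k`-semialgebraic for `k`-semialgebraic `S`.
* `Grounding.volume_eq_lintegral_fibre` (Cavalieri), `Grounding.volume_groundLast`,
  `Grounding.exists_downset_volume_eq` — **every `k`-semialgebraic subset of `ℝ^{m+1}` has the
  volume of a `k`-semialgebraic coordinatewise down-set of the open positive orthant**.

## References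

* J. Bochnak, M. Coste, M.-F. Roy, *Real Algebraic Geometry*, Springer (1998), Thm. 2.2.1
  (Tarski–Seidenberg), §2.3 (semialgebraic subsets of the line).
* M. Yoshinaga, *Periods and elementary real numbers*, arXiv:0805.0349 (2008), §3.2 (the bounded
  reduction which this construction replaces).

## Design notes

* Only bookkeeping definitions (`enum`, `gap`, `fibre`, `lengthGT`, `intervalWitness`, `groundLast`,
  `perm`, `groundAt`, `groundIter`); no named facts. Down-set and positivity properties are stated
  as explicit binders, coordinate by coordinate, in the form consumed by `DownSetTailDecay.lean`.
* Lengths are compared in `ℝ≥0∞` (`ENNReal.ofReal t < volume S_β`), so fibres of infinite length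
  are grounded to a half-line; no finiteness is needed for the volume identity.
-/

noncomputable section

open MeasureTheory Set Filter Topology
open scoped ENNReal

namespace Literature.NumberTheory.Transcendental

namespace FibreLength

/-! ### The complementary intervals of a finite subset of `ℝ` -/

/-- The increasing enumeration of a finite set of reals. [folklore] -/
def enum (R : Finset ℝ) : Fin R.card ↪o ℝ := R.orderEmbOfFin rfl

/-- The `i`-th complementary open interval ("gap") of a finite set `R ⊆ ℝ`, `0 ≤ i ≤ #R`: the reals
above the first `i` points of `R` and below the others. [folklore] -/
def gap (R : Finset ℝ) (i : Fin (R.card + 1)) : Set ℝ :=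
  {u | (∀ k : Fin R.card, (k : ℕ) < i → enum R k < u) ∧ ∀ k : Fin R.card, (i : ℕ) ≤ k → u < enum R k}

variable {R : Finset ℝ}

/-- Every point of `R` is enumerated. [folklore] -/
theorem exists_enum_eq {x : ℝ} (hx : x ∈ R) : ∃ k, enum R k = x := by
  have : x ∈ Set.range (enum R) := by
    rw [enum, Finset.range_orderEmbOfFin]; exact hx
  exact this

/-- Enumerated points belong to `R`. [folklore] -/
theorem enum_mem (k : Fin R.card) : enum R k ∈ R := by
  have : enum R k ∈ Set.range (enum R) := ⟨k, rfl⟩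
  rw [enum, Finset.range_orderEmbOfFin] at this
  exact this

/-- Gaps avoid `R`. [folklore] -/
theorem not_mem_of_mem_gap {i : Fin (R.card + 1)} {u : ℝ} (hu : u ∈ gap R i) : u ∉ (R : Set ℝ) := by
  intro huR
  obtain ⟨k, rfl⟩ := exists_enum_eq (Finset.mem_coe.1 huR)
  rcases lt_or_ge (k : ℕ) i with h | h
  · exact lt_irrefl _ (hu.1 k h)
  · exact lt_irrefl _ (hu.2 k h)

/-- The gaps cover the complement of `R`. [folklore] -/
theorem exists_mem_gap {u : ℝ} (hu : u ∉ (R : Set ℝ)) : ∃ i, u ∈ gap R i := by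
  classical
  have hne : ∀ k, enum R k ≠ u := fun k h => hu (h ▸ Finset.mem_coe.2 (enum_mem k))
  by_cases h : ∃ k : Fin R.card, u < enum R k
  · obtain ⟨k₀, hk₀, hmin⟩ := (Finset.univ.filter fun k : Fin R.card => u < enum R k).exists_min_image
      (fun k => k) (by obtain ⟨k, hk⟩ := h; exact ⟨k, Finset.mem_filter.2 ⟨Finset.mem_univ _, hk⟩⟩)
    rw [Finset.mem_filter] at hk₀
    refine ⟨⟨k₀, Nat.lt_succ_of_lt k₀.isLt⟩, fun k hk => ?_, fun k hk => ?_⟩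
    · have hk' : ¬ u < enum R k := fun h' =>
        absurd (hmin k (Finset.mem_filter.2 ⟨Finset.mem_univ _, h'⟩)) (not_le.2 (Fin.lt_def.2 hk))
      exact lt_of_le_of_ne (not_lt.1 hk') (hne k)
    · exact lt_of_lt_of_le hk₀.2 ((enum R).monotone (Fin.le_def.2 hk))
  · push Not at h
    refine ⟨Fin.last _, fun k _ => lt_of_le_of_ne (h k) (hne k), fun k hk => ?_⟩
    exact absurd k.isLt (not_lt.2 hk)

/-- Gaps are order-connected. [folklore] -/
theorem ordConnected_gap (i : Fin (R.card + 1)) : (gap R i).OrdConnected := by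
  refine ⟨fun u hu u' hu' w hw => ⟨fun k hk => ?_, fun k hk => ?_⟩⟩
  · exact lt_of_lt_of_le (hu.1 k hk) hw.1
  · exact lt_of_le_of_lt hw.2 (hu'.2 k hk)

/-- Gaps are preconnected. [folklore] -/
theorem isPreconnected_gap (i : Fin (R.card + 1)) : IsPreconnected (gap R i) :=
  (ordConnected_gap i).isPreconnected

/-- Points of a lower gap lie below points of a higher gap, with a point of `R` in between.
[folklore] -/
theorem lt_of_mem_gap {i j : Fin (R.card + 1)} (hij : (i : ℕ) < j) {u u' : ℝ} (hu : u ∈ gap R i)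
    (hu' : u' ∈ gap R j) : u < u' := by
  have hi : (i : ℕ) < R.card := lt_of_lt_of_le hij (Nat.lt_succ_iff.1 j.isLt)
  exact (hu.2 ⟨i, hi⟩ le_rfl).trans (hu'.1 ⟨i, hi⟩ hij)

/-! ### Locally constant membership on a preconnected set -/

/-- If membership in `F` is locally constant at every point of a preconnected set `C`, then `C`
lies inside `F` or is disjoint from it. [folklore] -/
theorem subset_or_disjoint_of_isPreconnected {F C : Set ℝ} (hC : IsPreconnected C)
    (hloc : ∀ u ∈ C, ∀ᶠ u' in 𝓝 u, u' ∈ F ↔ u ∈ F) : C ⊆ F ∨ Disjoint C F := by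
  set U : Set ℝ := {u | ∀ᶠ u' in 𝓝 u, u' ∈ F} with hU
  set V : Set ℝ := {u | ∀ᶠ u' in 𝓝 u, u' ∉ F} with hV
  have hUo : IsOpen U := isOpen_setOf_eventually_nhds
  have hVo : IsOpen V := isOpen_setOf_eventually_nhds
  have hUV : Disjoint U V := by
    rw [Set.disjoint_left]
    intro u hu hv
    have := (hu.and hv).self_of_nhds
    exact this.2 this.1
  have hcov : C ⊆ U ∪ V := by
    intro u hu
    by_cases h : u ∈ F
    · exact Or.inl ((hloc u hu).mono fun u' hu' => hu'.2 h)
    · exact Or.inr ((hloc u hu).mono fun u' hu' hu'F => h (hu'.1 hu'F))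
  rcases hC.subset_or_subset hUo hVo hUV hcov with h | h
  · exact Or.inl fun u hu => (show ∀ᶠ u' in 𝓝 u, u' ∈ F from h hu).self_of_nhds
  · refine Or.inr (Set.disjoint_left.2 fun u hu huF => ?_)
    exact (show ∀ᶠ u' in 𝓝 u, u' ∉ F from h hu).self_of_nhds huF

/-! ### Length and finite systems of disjoint open intervals -/

/-- `ofReal` of a finite sum is at most the sum of the `ofReal`s. [folklore] -/
theorem ofReal_sum_le {ι : Type*} (s : Finset ι) (f : ι → ℝ) :
    ENNReal.ofReal (∑ i ∈ s, f i) ≤ ∑ i ∈ s, ENNReal.ofReal (f i) := by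
  classical
  induction s using Finset.induction_on with
  | empty => simp
  | insert a s ha ih =>
    rw [Finset.sum_insert ha, Finset.sum_insert ha]
    exact (ENNReal.ofReal_add_le).trans (add_le_add le_rfl ih)

/-- **Easy direction.** Disjoint open intervals inside `F` of total length `> t ≥ 0` force
`vol F > t`. [folklore] -/
theorem lt_volume_of_intervals {F : Set ℝ} {B : ℕ} {t : ℝ} (ht : 0 ≤ t) (a b : Fin (B + 1) → ℝ)
    (hdisj : ∀ j j', j ≠ j' → a j < b j → a j' < b j' → b j ≤ a j' ∨ b j' ≤ a j)
    (hsub : ∀ j, Ioo (a j) (b j) ⊆ F) (hsum : t < ∑ j, (b j - a j)) :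
    ENNReal.ofReal t < volume F := by
  have hpd : Pairwise (Function.onFun Disjoint fun j => Ioo (a j) (b j)) := by
    intro j j' hne
    rw [Function.onFun, Set.disjoint_left]
    intro u hu hu'
    rcases hdisj j j' hne (hu.1.trans hu.2) (hu'.1.trans hu'.2) with h | h
    · linarith [hu.2, hu'.1]
    · linarith [hu'.2, hu.1]
  have h1 : volume (⋃ j, Ioo (a j) (b j)) = ∑ j, ENNReal.ofReal (b j - a j) := by
    rw [measure_iUnion hpd fun j => measurableSet_Ioo, tsum_fintype]
    simp [Real.volume_Ioo]
  have h2 : ENNReal.ofReal t < ENNReal.ofReal (∑ j, (b j - a j)) := by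
    rw [ENNReal.ofReal_lt_ofReal_iff']
    exact ⟨hsum, lt_of_le_of_lt ht hsum⟩
  calc ENNReal.ofReal t < ENNReal.ofReal (∑ j, (b j - a j)) := h2
    _ ≤ ∑ j, ENNReal.ofReal (b j - a j) := ofReal_sum_le _ _
    _ = volume (⋃ j, Ioo (a j) (b j)) := h1.symm
    _ ≤ volume F := measure_mono (iUnion_subset hsub)

/-- **Hard direction.** If membership in `F ⊆ ℝ` is locally constant off a finite set `R` with
`#R ≤ B` and `vol F > t ≥ 0`, then there are `B + 1` open intervals inside `F`, pairwise disjoint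
as far as they are nonempty, of total length `> t`: on each complementary interval of `R`
membership is constant (connectedness), so `F` is, up to the null set `R`, the union of the
complementary intervals it contains; truncate them to a large window `(-T, T)` chosen by
continuity of measure from below. [folklore] -/
theorem exists_intervals_of_lt_volume {F : Set ℝ} {R : Finset ℝ} {B : ℕ} (hB : R.card ≤ B)
    (hloc : ∀ u ∉ (R : Set ℝ), ∀ᶠ u' in 𝓝 u, u' ∈ F ↔ u ∈ F) {t : ℝ} (ht : 0 ≤ t)
    (hlt : ENNReal.ofReal t < volume F) :
    ∃ a b : Fin (B + 1) → ℝ,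
      (∀ j j', j ≠ j' → a j < b j → a j' < b j' → b j ≤ a j' ∨ b j' ≤ a j) ∧
      (∀ j, Ioo (a j) (b j) ⊆ F) ∧ t < ∑ j, (b j - a j) := by
  classical
  -- a window `(-T, T)` capturing more than `t` of the volume of `F`
  have hmono : Monotone fun N : ℕ => F ∩ Ioo (-(N : ℝ)) N := by
    intro N N' h u hu
    have hNN' : (N : ℝ) ≤ N' := by exact_mod_cast h
    have h1 := hu.2.1
    have h2 := hu.2.2
    exact ⟨hu.1, by linarith, by linarith⟩
  have hU : (⋃ N : ℕ, F ∩ Ioo (-(N : ℝ)) N) = F := by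
    ext u
    simp only [mem_iUnion, mem_inter_iff, mem_Ioo]
    constructor
    · rintro ⟨N, hu, -⟩; exact hu
    · intro hu
      obtain ⟨N, hN⟩ := exists_nat_gt |u|
      exact ⟨N, hu, by rw [abs_lt] at hN; exact hN.1, by rw [abs_lt] at hN; exact hN.2⟩
  have htend := tendsto_measure_iUnion_atTop (μ := volume) hmono
  rw [hU] at htend
  obtain ⟨N, hN⟩ := (htend.eventually_const_lt hlt).exists
  set T : ℝ := (N : ℝ) with hT
  set W : Set ℝ := F ∩ Ioo (-T) T with hW
  have hWlt : ENNReal.ofReal t < volume W := hN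
  have hWfin : volume W ≠ ⊤ :=
    (lt_of_le_of_lt (measure_mono inter_subset_right) (by simp [Real.volume_Ioo])).ne
  -- gaps inside `F` and their truncations
  have hgapF : ∀ i : Fin (R.card + 1), gap R i ⊆ F ∨ Disjoint (gap R i) F := fun i =>
    subset_or_disjoint_of_isPreconnected (isPreconnected_gap i)
      fun u hu => hloc u (not_mem_of_mem_gap hu)
  set tg : Fin (R.card + 1) → Set ℝ := fun i => gap R i ∩ Ioo (-T) T with htg
  have htg_bddA : ∀ i, BddAbove (tg i) := fun i => ⟨T, fun u hu => hu.2.2.le⟩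
  have htg_bddB : ∀ i, BddBelow (tg i) := fun i => ⟨-T, fun u hu => hu.2.1.le⟩
  have htg_oc : ∀ i, (tg i).OrdConnected := fun i => (ordConnected_gap i).inter ordConnected_Ioo
  -- the slots
  let good : Fin (B + 1) → Prop := fun j =>
    ∃ h : (j : ℕ) < R.card + 1, gap R ⟨j, h⟩ ⊆ F ∧ (tg ⟨j, h⟩).Nonempty
  have hlt_of_good : ∀ {j}, good j → (j : ℕ) < R.card + 1 := fun h => h.1
  let idx : ∀ j : Fin (B + 1), good j → Fin (R.card + 1) := fun j h => ⟨j, h.1⟩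
  have hgood_spec : ∀ j (h : good j), gap R (idx j h) ⊆ F ∧ (tg (idx j h)).Nonempty :=
    fun j h => h.2
  set a : Fin (B + 1) → ℝ := fun j => if h : good j then sInf (tg (idx j h)) else 0 with ha
  set b : Fin (B + 1) → ℝ := fun j => if h : good j then sSup (tg (idx j h)) else 0 with hb
  have ha_good : ∀ j (h : good j), a j = sInf (tg (idx j h)) := fun j h => by
    simp only [ha, dif_pos h]
  have hb_good : ∀ j (h : good j), b j = sSup (tg (idx j h)) := fun j h => by
    simp only [hb, dif_pos h]
  have ha_bad : ∀ j, ¬ good j → a j = 0 := fun j h => by simp only [ha, dif_neg h]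
  have hb_bad : ∀ j, ¬ good j → b j = 0 := fun j h => by simp only [hb, dif_neg h]
  -- basic properties of the good slots
  have hIcc : ∀ j (h : good j), tg (idx j h) ⊆ Icc (a j) (b j) := fun j h u hu => by
    rw [ha_good j h, hb_good j h]
    exact ⟨csInf_le (htg_bddB _) hu, le_csSup (htg_bddA _) hu⟩
  have hab : ∀ j, a j ≤ b j := by
    intro j
    by_cases h : good j
    · obtain ⟨u, hu⟩ := (hgood_spec j h).2
      exact ((hIcc j h hu).1).trans (hIcc j h hu).2
    · rw [ha_bad j h, hb_bad j h]
  have hIoo : ∀ j (h : good j), Ioo (a j) (b j) ⊆ tg (idx j h) := by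
    intro j h u hu
    rw [ha_good j h, hb_good j h] at hu
    obtain ⟨u₁, hu₁, hu₁u⟩ := exists_lt_of_csInf_lt (hgood_spec j h).2 hu.1
    obtain ⟨u₂, hu₂, huu₂⟩ := exists_lt_of_lt_csSup (hgood_spec j h).2 hu.2
    exact (htg_oc _).out hu₁ hu₂ ⟨hu₁u.le, huu₂.le⟩
  have hvol : ∀ j (h : good j), (volume (tg (idx j h))).toReal ≤ b j - a j := by
    intro j h
    have := measure_mono (μ := volume) (hIcc j h)
    rw [Real.volume_Icc] at this
    have h2 := ENNReal.toReal_mono ENNReal.ofReal_ne_top this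
    rwa [ENNReal.toReal_ofReal (by linarith [hab j])] at h2
  refine ⟨a, b, ?_, ?_, ?_⟩
  · -- disjointness of the nonempty slots
    intro j j' hne hj hj'
    have hgj : good j := by
      by_contra h; rw [ha_bad j h, hb_bad j h] at hj; exact lt_irrefl _ hj
    have hgj' : good j' := by
      by_contra h; rw [ha_bad j' h, hb_bad j' h] at hj'; exact lt_irrefl _ hj'
    have hne' : (j : ℕ) ≠ j' := fun h => hne (Fin.ext h)
    rcases lt_or_gt_of_ne hne' with h | h
    · left
      rw [hb_good j hgj, ha_good j' hgj']
      refine csSup_le (hgood_spec j hgj).2 fun u hu => le_csInf (hgood_spec j' hgj').2 fun u' hu' => ?_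
      exact (lt_of_mem_gap (i := idx j hgj) (j := idx j' hgj') h hu.1 hu'.1).le
    · right
      rw [hb_good j' hgj', ha_good j hgj]
      refine csSup_le (hgood_spec j' hgj').2 fun u hu => le_csInf (hgood_spec j hgj).2 fun u' hu' => ?_
      exact (lt_of_mem_gap (i := idx j' hgj') (j := idx j hgj) h hu.1 hu'.1).le
  · -- the intervals lie in `F`
    intro j
    by_cases h : good j
    · exact (hIoo j h).trans (inter_subset_left.trans (hgood_spec j h).1)
    · rw [ha_bad j h, hb_bad j h, Ioo_self]; exact empty_subset _
  · -- total length
    set G : Finset (Fin (B + 1)) := Finset.univ.filter fun j => good j with hG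
    have hcover : W ⊆ (R : Set ℝ) ∪ ⋃ j ∈ G, (fun j => if h : good j then tg (idx j h) else ∅) j := by
      intro u hu
      by_cases huR : u ∈ (R : Set ℝ)
      · exact Or.inl huR
      right
      obtain ⟨i, hi⟩ := exists_mem_gap huR
      have hiF : gap R i ⊆ F := by
        rcases hgapF i with h | h
        · exact h
        · exact absurd hu.1 (Set.disjoint_left.1 h hi)
      have hjlt : (i : ℕ) < B + 1 := lt_of_lt_of_le i.isLt (Nat.succ_le_succ hB)
      set j : Fin (B + 1) := ⟨i, hjlt⟩ with hj
      have hidx : (⟨(j : ℕ), i.isLt⟩ : Fin (R.card + 1)) = i := Fin.ext rfl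
      have hgj : good j := ⟨i.isLt, by rw [hidx]; exact ⟨hiF, u, hi, hu.2⟩⟩
      simp only [mem_iUnion, exists_prop]
      refine ⟨j, Finset.mem_filter.2 ⟨Finset.mem_univ _, hgj⟩, ?_⟩
      rw [dif_pos hgj]
      show u ∈ tg ⟨(j : ℕ), hgj.1⟩
      rw [show (⟨(j : ℕ), hgj.1⟩ : Fin (R.card + 1)) = i from Fin.ext rfl]
      exact ⟨hi, hu.2⟩
    have hRnull : volume (R : Set ℝ) = 0 := R.finite_toSet.measure_zero _
    have hpiece_fin : ∀ j ∈ G, volume ((fun j => if h : good j then tg (idx j h) else ∅) j) ≠ ⊤ := by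
      intro j _
      simp only
      split_ifs with h
      · exact (lt_of_le_of_lt (measure_mono inter_subset_right) (by simp [Real.volume_Ioo])).ne
      · simp
    have h1 : volume W ≤ ∑ j ∈ G, volume ((fun j => if h : good j then tg (idx j h) else ∅) j) := by
      calc volume W ≤ volume ((R : Set ℝ) ∪ ⋃ j ∈ G, (fun j => if h : good j then tg (idx j h) else ∅) j) :=
            measure_mono hcover
        _ ≤ volume (R : Set ℝ) + volume (⋃ j ∈ G, (fun j => if h : good j then tg (idx j h) else ∅) j) :=
            measure_union_le _ _
        _ ≤ 0 + ∑ j ∈ G, volume ((fun j => if h : good j then tg (idx j h) else ∅) j) := by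
            rw [hRnull]; exact add_le_add le_rfl (measure_biUnion_finset_le _ _)
        _ = _ := zero_add _
    have h2 : (volume W).toReal ≤
        ∑ j ∈ G, (volume ((fun j => if h : good j then tg (idx j h) else ∅) j)).toReal := by
      rw [← ENNReal.toReal_sum hpiece_fin]
      exact ENNReal.toReal_mono (ENNReal.sum_ne_top.2 hpiece_fin) h1
    have h3 : ∑ j ∈ G, (volume ((fun j => if h : good j then tg (idx j h) else ∅) j)).toReal ≤
        ∑ j ∈ G, (b j - a j) := by
      refine Finset.sum_le_sum fun j hj => ?_
      have hgj : good j := (Finset.mem_filter.1 hj).2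
      simp only [dif_pos hgj]
      exact hvol j hgj
    have h4 : ∑ j ∈ G, (b j - a j) ≤ ∑ j, (b j - a j) :=
      Finset.sum_le_sum_of_subset_of_nonneg (Finset.filter_subset _ _)
        fun j _ _ => by linarith [hab j]
    have h5 : t < (volume W).toReal := (ENNReal.ofReal_lt_iff_lt_toReal ht hWfin).1 hWlt
    linarith

/-! ### Fibres of semialgebraic sets: membership is locally constant off a bounded finite set -/

section Semialgebraic

variable {k : Type*} [CommRing k] [Algebra k ℝ] {m : ℕ}

open Literature.ModelTheory.ExponentialFields MvPolynomial in
/-- **Uniformly finitely many switching points.** For a `k`-semialgebraic `S ⊆ ℝ^{m+1}` there is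
`B` such that over every `β ∈ ℝ^m` membership of `(β, u)` in `S` is a locally constant function of
`u` off a set of at most `B` reals (the roots of the nonzero specialisations of a sign-condition
presentation of `S`; cf. `IsSemialgebraic.exists_forall_encard_fibre_one_le`).
[cite: BochnakCosteRoy1998, §2.3] -/
theorem exists_card_le_locallyConst {S : Set (Fin (m + 1) → ℝ)} (hS : IsSemialgebraic k S) :
    ∃ B : ℕ, ∀ β : Fin m → ℝ, ∃ R : Finset ℝ, R.card ≤ B ∧
      ∀ u ∉ (R : Set ℝ), ∀ᶠ u' in 𝓝 u,
        ((Fin.snoc β u' : Fin (m + 1) → ℝ) ∈ S ↔ (Fin.snoc β u : Fin (m + 1) → ℝ) ∈ S) := by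
  classical
  obtain ⟨Q, T, rfl⟩ := hS.exists_eq_setOf_signVec_mem
  refine ⟨∑ q ∈ Q, q.totalDegree, fun β => ?_⟩
  set Rt : Finset ℝ := Q.biUnion fun q =>
    if specLast q β = 0 then ∅ else (specLast q β).roots.toFinset with hRt
  refine ⟨Rt, ?_, fun u hu => ?_⟩
  · refine Finset.card_biUnion_le.trans (Finset.sum_le_sum fun q _ => ?_)
    split_ifs with h0
    · simp
    · exact (Multiset.toFinset_card_le _).trans
        (((specLast q β).card_roots').trans (natDegree_specLast_le q β))
  · have hne : ∀ q ∈ Q, specLast q β ≠ 0 → (specLast q β).eval u ≠ 0 := by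
      intro q hq hq0 heval
      apply hu
      rw [Finset.mem_coe, hRt, Finset.mem_biUnion]
      refine ⟨q, hq, ?_⟩
      rw [if_neg hq0, Multiset.mem_toFinset, Polynomial.mem_roots hq0]
      exact heval
    have hloc : ∀ q ∈ Q, ∀ᶠ u' in 𝓝 u,
        SignType.sign ((specLast q β).eval u') = SignType.sign ((specLast q β).eval u) := by
      intro q hq
      by_cases hq0 : specLast q β = 0
      · simp [hq0]
      · have hcont : ContinuousAt (fun u' => (specLast q β).eval u') u :=
          (specLast q β).continuous.continuousAt
        rcases lt_trichotomy ((specLast q β).eval u) 0 with hlt | heq | hgt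
        · filter_upwards [hcont.eventually (gt_mem_nhds hlt)] with u' hu'
          rw [sign_neg hu', sign_neg hlt]
        · exact (hne q hq hq0 heq).elim
        · filter_upwards [hcont.eventually (lt_mem_nhds hgt)] with u' hu'
          rw [sign_pos hu', sign_pos hgt]
    filter_upwards [(Q.eventually_all).2 hloc] with u' hu'
    have e : (fun q : Q => SignType.sign (aeval (Fin.snoc β u' : Fin (m + 1) → ℝ)
        (q : MvPolynomial (Fin (m + 1)) k))) =
        fun q : Q => SignType.sign (aeval (Fin.snoc β u : Fin (m + 1) → ℝ)
          (q : MvPolynomial (Fin (m + 1)) k)) := by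
      funext q
      rw [← eval_specLast, ← eval_specLast, hu' q q.2]
    show (fun q : Q => SignType.sign (aeval (Fin.snoc β u' : Fin (m + 1) → ℝ)
        (q : MvPolynomial (Fin (m + 1)) k))) ∈ T ↔
      (fun q : Q => SignType.sign (aeval (Fin.snoc β u : Fin (m + 1) → ℝ)
        (q : MvPolynomial (Fin (m + 1)) k))) ∈ T
    rw [e]

/-! ### The length of the last-coordinate fibre is a first-order quantity -/

/-- The fibre of `S ⊆ ℝ^{m+1}` over `β ∈ ℝ^m` in the last coordinate. [folklore] -/
def fibre (S : Set (Fin (m + 1) → ℝ)) (β : Fin m → ℝ) : Set ℝ :=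
  {u | (Fin.snoc β u : Fin (m + 1) → ℝ) ∈ S}

/-- The set `{(β, t) | t < length of the fibre S_β}` (`length = ` one-dimensional Lebesgue measure,
compared in `ℝ≥0∞`). [folklore] -/
def lengthGT (S : Set (Fin (m + 1) → ℝ)) : Set (Fin (m + 1) → ℝ) :=
  {v | ENNReal.ofReal (v (Fin.last m)) < volume (fibre S (Fin.init v))}

/-- The first-order description of `lengthGT S` on `{t ≥ 0}` with `B + 1` interval slots: there are
open intervals `(a_j, b_j)`, pairwise disjoint as far as they are nonempty, inside the fibre, of
total length `> t`. [folklore] -/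
def intervalWitness (S : Set (Fin (m + 1) → ℝ)) (B : ℕ) : Set (Fin (m + 1) → ℝ) :=
  {v | ∃ a b : Fin (B + 1) → ℝ,
    (∀ j j', j ≠ j' → a j < b j → a j' < b j' → b j ≤ a j' ∨ b j' ≤ a j) ∧
    (∀ j, ∀ u, a j < u → u < b j → (Fin.snoc (Fin.init v) u : Fin (m + 1) → ℝ) ∈ S) ∧
    v (Fin.last m) < ∑ j, (b j - a j)}

/-- **The interval description is correct** for `t ≥ 0`, when `B` bounds the number of switching
points of every fibre. [folklore] -/
theorem mem_intervalWitness_iff {S : Set (Fin (m + 1) → ℝ)} {B : ℕ}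
    (hB : ∀ β : Fin m → ℝ, ∃ R : Finset ℝ, R.card ≤ B ∧
      ∀ u ∉ (R : Set ℝ), ∀ᶠ u' in 𝓝 u,
        ((Fin.snoc β u' : Fin (m + 1) → ℝ) ∈ S ↔ (Fin.snoc β u : Fin (m + 1) → ℝ) ∈ S))
    {v : Fin (m + 1) → ℝ} (hv : 0 ≤ v (Fin.last m)) :
    v ∈ intervalWitness S B ↔ v ∈ lengthGT S := by
  constructor
  · rintro ⟨a, b, hdisj, hsub, hsum⟩
    exact lt_volume_of_intervals hv a b hdisj (fun j u hu => hsub j u hu.1 hu.2) hsum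
  · intro hlt
    obtain ⟨R, hRB, hloc⟩ := hB (Fin.init v)
    obtain ⟨a, b, hdisj, hsub, hsum⟩ :=
      exists_intervals_of_lt_volume (F := fibre S (Fin.init v)) hRB hloc hv hlt
    exact ⟨a, b, hdisj, fun j u h1 h2 => hsub j ⟨h1, h2⟩, hsum⟩

open Literature.ModelTheory.ExponentialFields MvPolynomial in
/-- **The interval description is semialgebraic** (Tarski–Seidenberg: the interval endpoints are
`2(B+1)` extra coordinates, projected away; "the interval lies in the fibre" is the complement of a
projection). [cite: BochnakCosteRoy1998, Thm. 2.2.1] -/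
theorem isSemialgebraic_intervalWitness {S : Set (Fin (m + 1) → ℝ)} (hS : IsSemialgebraic k S)
    (B : ℕ) : IsSemialgebraic k (intervalWitness S B) := by
  classical
  -- coordinates: `w = (v, a, b) ∈ ℝ^{(m+1) + ((B+1) + (B+1))}`
  let ιv : Fin (m + 1) → Fin (m + 1 + (B + 1 + (B + 1))) := Fin.castAdd (B + 1 + (B + 1))
  let ιa : Fin (B + 1) → Fin (m + 1 + (B + 1 + (B + 1))) := fun j =>
    Fin.natAdd (m + 1) (Fin.castAdd (B + 1) j)
  let ιb : Fin (B + 1) → Fin (m + 1 + (B + 1 + (B + 1))) := fun j =>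
    Fin.natAdd (m + 1) (Fin.natAdd (B + 1) j)
  -- the three conditions as sets of `w`
  let T₁ : Fin (B + 1) → Fin (B + 1) → Set (Fin (m + 1 + (B + 1 + (B + 1))) → ℝ) := fun j j' =>
    {w | j ≠ j' → w (ιa j) < w (ιb j) → w (ιa j') < w (ιb j') →
      w (ιb j) ≤ w (ιa j') ∨ w (ιb j') ≤ w (ιa j)}
  let P : Fin (B + 1) → Set (Fin (m + 1 + (B + 1 + (B + 1))) → ℝ) := fun j =>
    {w | ∃ u, w (ιa j) < u ∧ u < w (ιb j) ∧
      (Fin.snoc (Fin.init (w ∘ ιv)) u : Fin (m + 1) → ℝ) ∉ S}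
  let Ψ₃ : Set (Fin (m + 1 + (B + 1 + (B + 1))) → ℝ) := {w | w (ιv (Fin.last m)) < ∑ j, (w (ιb j) - w (ιa j))}
  set Ψ : Set (Fin (m + 1 + (B + 1 + (B + 1))) → ℝ) :=
    (⋂ j ∈ (Finset.univ : Finset (Fin (B + 1))), ⋂ j' ∈ (Finset.univ : Finset (Fin (B + 1))),
      T₁ j j') ∩ (⋂ j ∈ (Finset.univ : Finset (Fin (B + 1))), (P j)ᶜ) ∩ Ψ₃ with hΨ
  -- atomic inequalities between coordinates are semialgebraic
  have hlt : ∀ i i' : Fin (m + 1 + (B + 1 + (B + 1))), IsSemialgebraic k {w : Fin (m + 1 + (B + 1 + (B + 1))) → ℝ | w i < w i'} := fun i i' => by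
    simpa using isSemialgebraic_setOf_eval_lt (k := k) (R := ℝ) (X i : MvPolynomial (Fin (m + 1 + (B + 1 + (B + 1)))) k) (X i')
  have hle : ∀ i i' : Fin (m + 1 + (B + 1 + (B + 1))), IsSemialgebraic k {w : Fin (m + 1 + (B + 1 + (B + 1))) → ℝ | w i ≤ w i'} := fun i i' => by
    simpa using isSemialgebraic_setOf_eval_le (k := k) (R := ℝ) (X i : MvPolynomial (Fin (m + 1 + (B + 1 + (B + 1)))) k) (X i')
  have hT₁ : ∀ j j', IsSemialgebraic k (T₁ j j') := by
    intro j j'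
    by_cases hjj : j = j'
    · have : T₁ j j' = univ := by
        ext w; simp only [mem_setOf_eq, mem_univ, iff_true, T₁]; intro h; exact absurd hjj h
      rw [this]; exact isSemialgebraic_univ
    · have : T₁ j j' = ({w | w (ιa j) < w (ιb j)} ∩ {w | w (ιa j') < w (ιb j')})ᶜ ∪
          ({w | w (ιb j) ≤ w (ιa j')} ∪ {w | w (ιb j') ≤ w (ιa j)}) := by
        ext w
        simp only [mem_setOf_eq, mem_union, mem_compl_iff, mem_inter_iff, not_and, T₁]
        constructor
        · intro h
          by_cases h1 : w (ιa j) < w (ιb j)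
          · by_cases h2 : w (ιa j') < w (ιb j')
            · exact Or.inr (h hjj h1 h2)
            · exact Or.inl fun _ => h2
          · exact Or.inl fun h1' => absurd h1' h1
        · rintro (h | h) _ h1 h2
          · exact absurd h2 (h h1)
          · exact h
      rw [this]
      exact ((hlt _ _).inter (hlt _ _)).compl.union ((hle _ _).union (hle _ _))
  -- "the interval lies in the fibre": complement of a projection
  have hP : ∀ j, IsSemialgebraic k (P j) := by
    intro j
    let θ : Fin (m + 1) → Fin (m + 1 + (B + 1 + (B + 1)) + 1) :=
      Fin.snoc (fun i : Fin m => Fin.castSucc (ιv (Fin.castSucc i))) (Fin.last (m + 1 + (B + 1 + (B + 1))))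
    have hθ : ∀ z : Fin (m + 1 + (B + 1 + (B + 1)) + 1) → ℝ,
        z ∘ θ = Fin.snoc (Fin.init ((z ∘ Fin.castSucc) ∘ ιv)) (z (Fin.last (m + 1 + (B + 1 + (B + 1))))) := by
      intro z
      funext i
      refine Fin.lastCases ?_ (fun i => ?_) i
      · simp [θ]
      · simp [θ, Fin.init]
    set Z : Set (Fin (m + 1 + (B + 1 + (B + 1)) + 1) → ℝ) :=
      {z | z (Fin.castSucc (ιa j)) < z (Fin.last (m + 1 + (B + 1 + (B + 1))))} ∩ {z | z (Fin.last (m + 1 + (B + 1 + (B + 1)))) < z (Fin.castSucc (ιb j))} ∩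
        ((fun z : Fin (m + 1 + (B + 1 + (B + 1)) + 1) → ℝ => z ∘ θ) ⁻¹' Sᶜ) with hZ
    have hZs : IsSemialgebraic k Z := by
      refine (IsSemialgebraic.inter ?_ ?_).inter (hS.compl.preimage_comp θ)
      · simpa using isSemialgebraic_setOf_eval_lt (k := k) (R := ℝ)
          (X (Fin.castSucc (ιa j)) : MvPolynomial (Fin (m + 1 + (B + 1 + (B + 1)) + 1)) k) (X (Fin.last (m + 1 + (B + 1 + (B + 1)))))
      · simpa using isSemialgebraic_setOf_eval_lt (k := k) (R := ℝ)
          (X (Fin.last (m + 1 + (B + 1 + (B + 1)))) : MvPolynomial (Fin (m + 1 + (B + 1 + (B + 1)) + 1)) k) (X (Fin.castSucc (ιb j)))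
    convert tarski_seidenberg_real_holds hZs using 1
    ext w
    simp only [mem_setOf_eq, mem_image, hZ, mem_inter_iff, mem_preimage, mem_compl_iff, P]
    constructor
    · rintro ⟨u, h1, h2, h3⟩
      refine ⟨Fin.snoc w u, ⟨⟨by simpa using h1, by simpa using h2⟩, ?_⟩, ?_⟩
      · rw [hθ]
        have : ((Fin.snoc w u : Fin (m + 1 + (B + 1 + (B + 1)) + 1) → ℝ) ∘ Fin.castSucc) = w := funext fun i => by simp
        rw [this]
        simpa using h3
      · exact funext fun i => by simp
    · rintro ⟨z, ⟨⟨h1, h2⟩, h3⟩, rfl⟩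
      refine ⟨z (Fin.last (m + 1 + (B + 1 + (B + 1)))), h1, h2, ?_⟩
      rw [hθ] at h3
      exact h3
  have hΨ₃ : IsSemialgebraic k Ψ₃ := by
    have := isSemialgebraic_setOf_eval_lt (k := k) (R := ℝ)
      (X (ιv (Fin.last m)) : MvPolynomial (Fin (m + 1 + (B + 1 + (B + 1)))) k)
      (∑ j, (X (ιb j) - X (ιa j)))
    show IsSemialgebraic k
      {w : Fin (m + 1 + (B + 1 + (B + 1))) → ℝ | w (ιv (Fin.last m)) < ∑ j, (w (ιb j) - w (ιa j))}
    simpa [map_sum, Finset.sum_sub_distrib] using this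
  have hΨs : IsSemialgebraic k Ψ := by
    refine (IsSemialgebraic.inter ?_ ?_).inter hΨ₃
    · exact IsSemialgebraic.biInter _ _ fun j _ => IsSemialgebraic.biInter _ _ fun j' _ => hT₁ j j'
    · exact IsSemialgebraic.biInter _ _ fun j _ => (hP j).compl
  -- `intervalWitness S B` is the projection of `Ψ` onto the `v`-coordinates
  convert hΨs.image_comp ιv using 1
  ext v
  simp only [intervalWitness, mem_setOf_eq, mem_image, hΨ, mem_inter_iff, mem_iInter,
    Finset.mem_univ, true_implies, mem_compl_iff, not_exists, not_and, not_not, T₁, P, Ψ₃]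
  constructor
  · rintro ⟨a, b, hdisj, hsub, hsum⟩
    refine ⟨Fin.append v (Fin.append a b), ⟨⟨fun j j' => ?_, fun j u h1 h2 => ?_⟩, ?_⟩, ?_⟩
    · simp only [ιa, ιb, Fin.append_right, Fin.append_left]
      exact hdisj j j'
    · have hv : (Fin.append v (Fin.append a b) ∘ ιv) = v := funext fun i => by
        simp only [ιv, Function.comp_apply, Fin.append_left]
      rw [hv]
      simp only [ιa, ιb, Fin.append_right, Fin.append_left] at h1 h2
      exact hsub j u h1 h2
    · simp only [ιv, ιa, ιb, Fin.append_right, Fin.append_left]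
      exact hsum
    · exact funext fun i => by simp only [ιv, Function.comp_apply, Fin.append_left]
  · rintro ⟨w, ⟨⟨hdisj, hsub⟩, hsum⟩, rfl⟩
    refine ⟨fun j => w (ιa j), fun j => w (ιb j), hdisj, fun j u h1 h2 => hsub j u h1 h2, ?_⟩
    simpa using hsum

open Literature.ModelTheory.ExponentialFields MvPolynomial in
/-- **Grounded fibres are semialgebraic.** For a `k`-semialgebraic `S ⊆ ℝ^{m+1}`, the set
`{(β, t) | 0 < t < length(S_β)}` obtained by replacing every last-coordinate fibre by the interval
`(0, its length)` is `k`-semialgebraic. [cite: BochnakCosteRoy1998, Thm. 2.2.1] -/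
theorem isSemialgebraic_pos_inter_lengthGT {S : Set (Fin (m + 1) → ℝ)} (hS : IsSemialgebraic k S) :
    IsSemialgebraic k {v : Fin (m + 1) → ℝ | 0 < v (Fin.last m) ∧ v ∈ lengthGT S} := by
  obtain ⟨B, hB⟩ := exists_card_le_locallyConst hS
  have hpos : IsSemialgebraic k {v : Fin (m + 1) → ℝ | 0 < v (Fin.last m)} := by
    simpa using isSemialgebraic_setOf_eval_pos (k := k) (R := ℝ)
      (X (Fin.last m) : MvPolynomial (Fin (m + 1)) k)
  convert hpos.inter (isSemialgebraic_intervalWitness hS B) using 1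
  ext v
  simp only [mem_setOf_eq, mem_inter_iff]
  constructor
  · rintro ⟨h1, h2⟩; exact ⟨h1, (mem_intervalWitness_iff hB h1.le).2 h2⟩
  · rintro ⟨h1, h2⟩; exact ⟨h1, (mem_intervalWitness_iff hB h1.le).1 h2⟩

end Semialgebraic

end FibreLength


open Literature.ModelTheory.ExponentialFields

namespace Grounding

variable {k : Type*} [CommRing k] [Algebra k ℝ] {m : ℕ}

/-! ### Grounding the last coordinate -/

/-- Grounding in the last coordinate: replace every fibre `S_β = {u | (β, u) ∈ S}` by the interval
`(0, length S_β)`. [folklore] -/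
def groundLast (S : Set (Fin (m + 1) → ℝ)) : Set (Fin (m + 1) → ℝ) :=
  {v | 0 < v (Fin.last m) ∧ v ∈ FibreLength.lengthGT S}

/-- Membership in a grounded set, unfolded. [folklore] -/
theorem mem_groundLast_iff {S : Set (Fin (m + 1) → ℝ)} {v : Fin (m + 1) → ℝ} :
    v ∈ groundLast S ↔ 0 < v (Fin.last m) ∧
      ENNReal.ofReal (v (Fin.last m)) < volume (FibreLength.fibre S (Fin.init v)) := Iff.rfl

/-- Grounded sets are semialgebraic (`FibreLength.isSemialgebraic_pos_inter_lengthGT`).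
[cite: BochnakCosteRoy1998, Thm. 2.2.1] -/
theorem isSemialgebraic_groundLast {S : Set (Fin (m + 1) → ℝ)} (hS : IsSemialgebraic k S) :
    IsSemialgebraic k (groundLast S) :=
  FibreLength.isSemialgebraic_pos_inter_lengthGT hS

/-- The length of `{u | 0 < u, u < L}` is `L`, for every `L ∈ [0, ∞]`. [folklore] -/
theorem volume_setOf_pos_ofReal_lt (L : ℝ≥0∞) :
    volume {u : ℝ | 0 < u ∧ ENNReal.ofReal u < L} = L := by
  rcases eq_or_ne L ⊤ with rfl | hL
  · have : {u : ℝ | 0 < u ∧ ENNReal.ofReal u < ⊤} = Ioi 0 := by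
      ext u; simp
    rw [this, Real.volume_Ioi]
  · have hL' : L = ENNReal.ofReal L.toReal := (ENNReal.ofReal_toReal hL).symm
    have : {u : ℝ | 0 < u ∧ ENNReal.ofReal u < L} = Ioo 0 L.toReal := by
      ext u
      simp only [mem_setOf_eq, mem_Ioo]
      constructor
      · rintro ⟨h0, h1⟩
        refine ⟨h0, ?_⟩
        rw [hL'] at h1
        exact (ENNReal.ofReal_lt_ofReal_iff_of_nonneg h0.le).1 h1
      · rintro ⟨h0, h1⟩
        refine ⟨h0, ?_⟩
        rw [hL']
        exact (ENNReal.ofReal_lt_ofReal_iff_of_nonneg h0.le).2 h1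
    rw [this, Real.volume_Ioo, sub_zero, ← hL']

/-- **Cavalieri.** The volume of a measurable `A ⊆ ℝ^{m+1}` is the integral of the lengths of its
last-coordinate fibres. [folklore] -/
theorem volume_eq_lintegral_fibre {A : Set (Fin (m + 1) → ℝ)} (hA : MeasurableSet A) :
    volume A = ∫⁻ β : Fin m → ℝ, volume (FibreLength.fibre A β) := by
  set e : (Fin (m + 1) → ℝ) ≃ᵐ ℝ × (Fin m → ℝ) :=
    MeasurableEquiv.piFinSuccAbove (fun _ => ℝ) (Fin.last m) with he_def
  have he : MeasurePreserving e volume (volume.prod volume) :=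
    volume_preserving_piFinSuccAbove (fun _ => ℝ) (Fin.last m)
  have hsymm : ∀ p : ℝ × (Fin m → ℝ), e.symm p = Fin.snoc p.2 p.1 := fun p => by
    rw [he_def, MeasurableEquiv.piFinSuccAbove_symm_apply, Fin.insertNthEquiv_last]
    rfl
  have h1 := he.symm.measure_preimage (μa := volume.prod volume) (s := A) hA.nullMeasurableSet
  rw [← h1, Measure.prod_apply_symm (e.symm.measurable hA)]
  refine lintegral_congr fun β => ?_
  congr 1
  ext u
  simp only [mem_preimage, hsymm, FibreLength.fibre, mem_setOf_eq]

/-- **Grounding preserves volume.** [folklore] -/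
theorem volume_groundLast {S : Set (Fin (m + 1) → ℝ)} (hS : MeasurableSet S)
    (hG : MeasurableSet (groundLast S)) : volume (groundLast S) = volume S := by
  rw [volume_eq_lintegral_fibre hS, volume_eq_lintegral_fibre hG]
  refine lintegral_congr fun β => ?_
  have : FibreLength.fibre (groundLast S) β =
      {u : ℝ | 0 < u ∧ ENNReal.ofReal u < volume (FibreLength.fibre S β)} := by
    ext u
    simp only [FibreLength.fibre, mem_setOf_eq, groundLast, FibreLength.lengthGT, Fin.snoc_last,
      Fin.init_snoc]
  rw [this, volume_setOf_pos_ofReal_lt]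

/-- The last coordinate is positive on a grounded set. [folklore] -/
theorem pos_last_of_mem_groundLast {S : Set (Fin (m + 1) → ℝ)} {v : Fin (m + 1) → ℝ}
    (hv : v ∈ groundLast S) : 0 < v (Fin.last m) := hv.1

/-- A grounded set is a down-set in the last coordinate. [folklore] -/
theorem update_last_mem_groundLast {S : Set (Fin (m + 1) → ℝ)} {v : Fin (m + 1) → ℝ}
    (hv : v ∈ groundLast S) {u : ℝ} (hu0 : 0 < u) (hu : u ≤ v (Fin.last m)) :
    Function.update v (Fin.last m) u ∈ groundLast S := by
  refine ⟨by simpa using hu0, ?_⟩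
  show ENNReal.ofReal (Function.update v (Fin.last m) u (Fin.last m)) <
    volume (FibreLength.fibre S (Fin.init (Function.update v (Fin.last m) u)))
  rw [Function.update_self, Fin.init_update_last]
  exact lt_of_le_of_lt (ENNReal.ofReal_le_ofReal hu) hv.2

/-- Grounding keeps a coordinate positive. [folklore] -/
theorem pos_of_mem_groundLast {S : Set (Fin (m + 1) → ℝ)} {j : Fin (m + 1)} (hj : j ≠ Fin.last m)
    (hS : ∀ x ∈ S, 0 < x j) {v : Fin (m + 1) → ℝ} (hv : v ∈ groundLast S) : 0 < v j := by
  obtain ⟨j₀, rfl⟩ := Fin.exists_castSucc_eq.2 hj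
  have hne : volume (FibreLength.fibre S (Fin.init v)) ≠ 0 := (bot_le.trans_lt hv.2).ne'
  obtain ⟨u, hu⟩ := nonempty_of_measure_ne_zero hne
  have := hS _ hu
  simpa [Fin.init] using this

/-- Grounding keeps a set a down-set in any other coordinate. [folklore] -/
theorem update_mem_groundLast {S : Set (Fin (m + 1) → ℝ)} {j : Fin (m + 1)} (hj : j ≠ Fin.last m)
    (hS : ∀ x ∈ S, ∀ u : ℝ, 0 < u → u ≤ x j → Function.update x j u ∈ S)
    {v : Fin (m + 1) → ℝ} (hv : v ∈ groundLast S) {u : ℝ} (hu0 : 0 < u) (hu : u ≤ v j) :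
    Function.update v j u ∈ groundLast S := by
  obtain ⟨j₀, rfl⟩ := Fin.exists_castSucc_eq.2 hj
  refine ⟨?_, ?_⟩
  · rw [Function.update_of_ne (Fin.castSucc_lt_last j₀).ne']
    exact hv.1
  · show ENNReal.ofReal (Function.update v (Fin.castSucc j₀) u (Fin.last m)) <
      volume (FibreLength.fibre S (Fin.init (Function.update v (Fin.castSucc j₀) u)))
    rw [Function.update_of_ne (Fin.castSucc_lt_last j₀).ne', Fin.init_update_castSucc]
    refine lt_of_lt_of_le hv.2 (measure_mono fun w hw => ?_)
    have h1 : (Fin.snoc (Fin.init v) w : Fin (m + 1) → ℝ) (Fin.castSucc j₀) = v (Fin.castSucc j₀) := by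
      simp [Fin.init]
    have := hS _ hw u hu0 (by rw [h1]; exact hu)
    rw [← Fin.snoc_update] at this
    exact this

/-! ### Transport by a permutation of the coordinates -/

/-- Precomposition with a permutation of the coordinates preserves Lebesgue measure. [folklore] -/
theorem measurePreserving_comp_perm (σ : Equiv.Perm (Fin (m + 1))) :
    MeasurePreserving (fun x : Fin (m + 1) → ℝ => x ∘ σ) volume volume := by
  have h := (volume_measurePreserving_piCongrLeft (fun _ : Fin (m + 1) => ℝ) σ).symm
  convert h using 1
  funext x
  funext a
  simp [MeasurableEquiv.piCongrLeft, Equiv.piCongrLeft_symm_apply]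

/-- Pull-back of a set by a permutation of the coordinates. [folklore] -/
def perm (σ : Equiv.Perm (Fin (m + 1))) (S : Set (Fin (m + 1) → ℝ)) : Set (Fin (m + 1) → ℝ) :=
  (fun x : Fin (m + 1) → ℝ => x ∘ σ) ⁻¹' S

/-- Membership in a pulled-back set, unfolded. [folklore] -/
theorem mem_perm {σ : Equiv.Perm (Fin (m + 1))} {S : Set (Fin (m + 1) → ℝ)} {x : Fin (m + 1) → ℝ} :
    x ∈ perm σ S ↔ x ∘ σ ∈ S := Iff.rfl

/-- Coordinate permutations preserve semialgebraicity. [folklore] -/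
theorem isSemialgebraic_perm (σ : Equiv.Perm (Fin (m + 1))) {S : Set (Fin (m + 1) → ℝ)}
    (hS : IsSemialgebraic k S) : IsSemialgebraic k (perm σ S) :=
  hS.preimage_comp σ

/-- Coordinate permutations preserve volume. [folklore] -/
theorem volume_perm (σ : Equiv.Perm (Fin (m + 1))) {S : Set (Fin (m + 1) → ℝ)}
    (hS : MeasurableSet S) : volume (perm σ S) = volume S :=
  (measurePreserving_comp_perm σ).measure_preimage hS.nullMeasurableSet

/-- Positivity of a coordinate, transported along a permutation. [folklore] -/
theorem pos_of_mem_perm {σ : Equiv.Perm (Fin (m + 1))} {S : Set (Fin (m + 1) → ℝ)} {j : Fin (m + 1)}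
    (hS : ∀ x ∈ S, 0 < x j) {x : Fin (m + 1) → ℝ} (hx : x ∈ perm σ S) : 0 < x (σ j) :=
  hS _ hx

/-- The down-set property in a coordinate, transported along a permutation. [folklore] -/
theorem update_mem_perm {σ : Equiv.Perm (Fin (m + 1))} {S : Set (Fin (m + 1) → ℝ)}
    {j : Fin (m + 1)} (hS : ∀ x ∈ S, ∀ u : ℝ, 0 < u → u ≤ x j → Function.update x j u ∈ S)
    {x : Fin (m + 1) → ℝ} (hx : x ∈ perm σ S) {u : ℝ} (hu0 : 0 < u) (hu : u ≤ x (σ j)) :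
    Function.update x (σ j) u ∈ perm σ S := by
  show Function.update x (σ j) u ∘ σ ∈ S
  rw [Function.update_comp_equiv, Equiv.symm_apply_apply]
  exact hS _ hx u hu0 hu

/-! ### Grounding an arbitrary coordinate -/

/-- Grounding in coordinate `i`: conjugate `groundLast` by the transposition `(i last)`. [folklore] -/
def groundAt (i : Fin (m + 1)) (S : Set (Fin (m + 1) → ℝ)) : Set (Fin (m + 1) → ℝ) :=
  perm (Equiv.swap i (Fin.last m)) (groundLast (perm (Equiv.swap i (Fin.last m)) S))

/-- Grounding a coordinate preserves semialgebraicity. [cite: BochnakCosteRoy1998, Thm. 2.2.1] -/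
theorem isSemialgebraic_groundAt (i : Fin (m + 1)) {S : Set (Fin (m + 1) → ℝ)}
    (hS : IsSemialgebraic k S) : IsSemialgebraic k (groundAt i S) :=
  isSemialgebraic_perm _ (isSemialgebraic_groundLast (isSemialgebraic_perm _ hS))

/-- Grounding a coordinate preserves volume. [folklore] -/
theorem volume_groundAt (i : Fin (m + 1)) {S : Set (Fin (m + 1) → ℝ)} (hS : IsSemialgebraic k S) :
    volume (groundAt i S) = volume S := by
  have h1 : IsSemialgebraic k (perm (Equiv.swap i (Fin.last m)) S) := isSemialgebraic_perm _ hS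
  have h2 : IsSemialgebraic k (groundLast (perm (Equiv.swap i (Fin.last m)) S)) :=
    isSemialgebraic_groundLast h1
  unfold groundAt
  rw [volume_perm _ (IsSemialgebraic.measurableSet_holds h2),
    volume_groundLast (IsSemialgebraic.measurableSet_holds h1) (IsSemialgebraic.measurableSet_holds h2),
    volume_perm _ (IsSemialgebraic.measurableSet_holds hS)]

/-- The grounded coordinate is positive. [folklore] -/
theorem pos_of_mem_groundAt_self (i : Fin (m + 1)) {S : Set (Fin (m + 1) → ℝ)}
    {x : Fin (m + 1) → ℝ} (hx : x ∈ groundAt i S) : 0 < x i := by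
  have := pos_of_mem_perm (σ := Equiv.swap i (Fin.last m)) (j := Fin.last m)
    (fun v hv => pos_last_of_mem_groundLast hv) hx
  simpa using this

/-- The set is a down-set in the grounded coordinate. [folklore] -/
theorem update_mem_groundAt_self (i : Fin (m + 1)) {S : Set (Fin (m + 1) → ℝ)}
    {x : Fin (m + 1) → ℝ} (hx : x ∈ groundAt i S) {u : ℝ} (hu0 : 0 < u) (hu : u ≤ x i) :
    Function.update x i u ∈ groundAt i S := by
  unfold groundAt at hx ⊢
  have := update_mem_perm (σ := Equiv.swap i (Fin.last m)) (j := Fin.last m)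
    (fun v hv w hw0 hw => update_last_mem_groundLast hv hw0 hw) hx hu0 (by simpa using hu)
  simpa using this

/-- Grounding a coordinate keeps the other coordinates positive. [folklore] -/
theorem pos_of_mem_groundAt (i : Fin (m + 1)) {S : Set (Fin (m + 1) → ℝ)} {j : Fin (m + 1)}
    (hj : j ≠ i) (hS : ∀ x ∈ S, 0 < x j) {x : Fin (m + 1) → ℝ} (hx : x ∈ groundAt i S) : 0 < x j := by
  set σ := Equiv.swap i (Fin.last m) with hσ
  have hσj : σ j ≠ Fin.last m := by
    intro h
    apply hj
    have : σ (σ j) = σ (Fin.last m) := by rw [h]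
    rw [hσ, Equiv.swap_apply_self, Equiv.swap_apply_right] at this
    exact this
  have h1 : ∀ x ∈ perm σ S, 0 < x (σ j) := fun x hx => pos_of_mem_perm hS hx
  have h2 : ∀ x ∈ groundLast (perm σ S), 0 < x (σ j) := fun x hx => pos_of_mem_groundLast hσj h1 hx
  have h3 := pos_of_mem_perm (σ := σ) h2 hx
  rwa [hσ, Equiv.swap_apply_self] at h3

/-- Grounding a coordinate keeps the down-set property in the other coordinates. [folklore] -/
theorem update_mem_groundAt (i : Fin (m + 1)) {S : Set (Fin (m + 1) → ℝ)} {j : Fin (m + 1)}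
    (hj : j ≠ i) (hS : ∀ x ∈ S, ∀ u : ℝ, 0 < u → u ≤ x j → Function.update x j u ∈ S)
    {x : Fin (m + 1) → ℝ} (hx : x ∈ groundAt i S) {u : ℝ} (hu0 : 0 < u) (hu : u ≤ x j) :
    Function.update x j u ∈ groundAt i S := by
  set σ := Equiv.swap i (Fin.last m) with hσ
  have hσj : σ j ≠ Fin.last m := by
    intro h
    apply hj
    have : σ (σ j) = σ (Fin.last m) := by rw [h]
    rw [hσ, Equiv.swap_apply_self, Equiv.swap_apply_right] at this
    exact this
  have h1 : ∀ x ∈ perm σ S, ∀ u : ℝ, 0 < u → u ≤ x (σ j) → Function.update x (σ j) u ∈ perm σ S :=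
    fun x hx u hu0 hu => update_mem_perm hS hx hu0 hu
  have h2 : ∀ x ∈ groundLast (perm σ S), ∀ u : ℝ, 0 < u → u ≤ x (σ j) →
      Function.update x (σ j) u ∈ groundLast (perm σ S) :=
    fun x hx u hu0 hu => update_mem_groundLast hσj h1 hx hu0 hu
  have hu' : u ≤ x (σ (σ j)) := by rwa [hσ, Equiv.swap_apply_self]
  have h3 := update_mem_perm (σ := σ) (j := σ j) h2 hx hu0 hu'
  rwa [hσ, Equiv.swap_apply_self] at h3

/-! ### Grounding all coordinates -/

/-- Grounding the coordinates `0, …, n-1` successively (bookkeeping). [folklore] -/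
def groundIter (S : Set (Fin (m + 1) → ℝ)) : ℕ → Set (Fin (m + 1) → ℝ)
  | 0 => S
  | n + 1 => if h : n < m + 1 then groundAt ⟨n, h⟩ (groundIter S n) else groundIter S n

/-- After grounding the first `n` coordinates: still semialgebraic, same volume, positive and a
down-set in each of the first `n` coordinates. [folklore] -/
theorem groundIter_spec {S : Set (Fin (m + 1) → ℝ)} (hS : IsSemialgebraic k S) (n : ℕ) :
    IsSemialgebraic k (groundIter S n) ∧ volume (groundIter S n) = volume S ∧
      (∀ i : Fin (m + 1), (i : ℕ) < n → (∀ x ∈ groundIter S n, 0 < x i) ∧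
        (∀ x ∈ groundIter S n, ∀ u : ℝ, 0 < u → u ≤ x i →
          Function.update x i u ∈ groundIter S n)) := by
  induction n with
  | zero => exact ⟨hS, rfl, fun i hi => absurd hi (Nat.not_lt_zero _)⟩
  | succ n ih =>
    obtain ⟨ih1, ih2, ih3⟩ := ih
    simp only [groundIter]
    split_ifs with h
    · refine ⟨isSemialgebraic_groundAt _ ih1, (volume_groundAt _ ih1).trans ih2, fun i hi => ?_⟩
      by_cases hin : (i : ℕ) = n
      · have hi' : i = ⟨n, h⟩ := Fin.ext hin
        subst hi'
        exact ⟨fun x hx => pos_of_mem_groundAt_self _ hx,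
          fun x hx u hu0 hu => update_mem_groundAt_self _ hx hu0 hu⟩
      · have hlt : (i : ℕ) < n := lt_of_le_of_ne (Nat.lt_succ_iff.1 hi) hin
        have hne : i ≠ ⟨n, h⟩ := fun h' => hin (by rw [h'])
        obtain ⟨h1, h2⟩ := ih3 i hlt
        exact ⟨fun x hx => pos_of_mem_groundAt _ hne h1 hx,
          fun x hx u hu0 hu => update_mem_groundAt _ hne h2 hx hu0 hu⟩
    · refine ⟨ih1, ih2, fun i hi => ih3 i ?_⟩
      exact lt_of_lt_of_le i.isLt (not_lt.1 h)

/-- A set which is a down-set in every coordinate separately (with positive coordinates) is a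
down-set for the coordinatewise order: change the coordinates one at a time. [folklore] -/
theorem mem_of_forall_update_mem {D : Set (Fin (m + 1) → ℝ)}
    (hdown : ∀ i, ∀ x ∈ D, ∀ u : ℝ, 0 < u → u ≤ x i → Function.update x i u ∈ D)
    {x : Fin (m + 1) → ℝ} (hx : x ∈ D) {y : Fin (m + 1) → ℝ} (hy : ∀ i, 0 < y i ∧ y i ≤ x i) :
    y ∈ D := by
  -- `z n` agrees with `y` on the coordinates `< n` and with `x` elsewhere
  let z : ℕ → (Fin (m + 1) → ℝ) := fun n i => if (i : ℕ) < n then y i else x i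
  have hz : ∀ n, z n ∈ D := by
    intro n
    induction n with
    | zero =>
      have : z 0 = x := funext fun i => by simp [z]
      rw [this]; exact hx
    | succ n ih =>
      by_cases h : n < m + 1
      · have hstep : z (n + 1) = Function.update (z n) ⟨n, h⟩ (y ⟨n, h⟩) := by
          funext i
          by_cases hi : i = ⟨n, h⟩
          · subst hi
            simp [z]
          · have hne : (i : ℕ) ≠ n := fun h' => hi (Fin.ext h')
            rw [Function.update_of_ne hi]
            have : ((i : ℕ) < n + 1) ↔ ((i : ℕ) < n) := by omega
            simp only [z, this]
        rw [hstep]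
        refine hdown ⟨n, h⟩ (z n) ih _ (hy _).1 ?_
        have : z n ⟨n, h⟩ = x ⟨n, h⟩ := by simp [z]
        rw [this]; exact (hy _).2
      · have : z (n + 1) = z n := funext fun i => by
          have h1 : (i : ℕ) < n := lt_of_lt_of_le i.isLt (not_lt.1 h)
          simp [z, h1, Nat.lt_succ_of_lt h1]
        rw [this]; exact ih
  have : z (m + 1) = y := funext fun i => by simp [z, i.isLt]
  rw [← this]; exact hz _

/-- **Grounding.** For every `k`-semialgebraic `S ⊆ ℝ^{m+1}` there is a `k`-semialgebraic subset
`D` of the open positive orthant which is a down-set for the coordinatewise order (`x ∈ D`,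
`0 < yᵢ ≤ xᵢ ∀ i` `⇒ y ∈ D`) and has the same volume as `S`: ground the coordinates one after the
other (each step replaces the fibres in one direction by intervals `(0, length)`, preserving volume
by Cavalieri's principle and semialgebraicity by Tarski–Seidenberg, and keeps the down-set
property in the directions already treated). [folklore] -/
theorem exists_downset_volume_eq {S : Set (Fin (m + 1) → ℝ)} (hS : IsSemialgebraic k S) :
    ∃ D : Set (Fin (m + 1) → ℝ), IsSemialgebraic k D ∧ (∀ x ∈ D, ∀ i, 0 < x i) ∧
      (∀ x ∈ D, ∀ y : Fin (m + 1) → ℝ, (∀ i, 0 < y i ∧ y i ≤ x i) → y ∈ D) ∧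
      volume D = volume S := by
  obtain ⟨h1, h2, h3⟩ := groundIter_spec hS (m + 1)
  refine ⟨groundIter S (m + 1), h1, fun x hx i => (h3 i i.isLt).1 x hx, fun x hx y hy => ?_, h2⟩
  exact mem_of_forall_update_mem (fun i => (h3 i i.isLt).2) hx hy

end Grounding

end Literature.NumberTheory.Transcendental
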